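import Literature.NumberTheory.Automorphic.PairLFunctionPoles
import HarnessLib

/-!
# The prime number theorem for `L(s, π × π̃)` (diagonal Rankin–Selberg PNT; Liu–Ye 2007)

Topic `NumberTheory/Automorphic`; namespace `Literature.NumberTheory.Automorphic`. ONE named fact
(D-0014, statement only), companion of the Jacquet–Shalika pole facts of `PairLFunctionPoles`
(Arthur–Clozel (2.2)–(2.3)) over the same objects: unitary cuspidal `π` in the tree's
`L²_cusp(GL_n(ℚ) A_G \ GL_n(𝔸_ℚ))` model (`CuspidalAutomorphicRepGL n ℚ μ`) with a Satake family
`α` off a finite set `S` of finite places (`IsSatakeFamilyOf`).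

## Source (read 2026-08-15, page-level)

J. Liu, Y. Ye, *Perron's formula and the prime number theorem for automorphic L-functions*,
Pure Appl. Math. Q. 3 (2007), no. 2, 481–497, **Lemma 5.2** (printed p. 492): "For any
automorphic irreducible cuspidal unitary representation `π` of `GL_m` over `ℚ`, not necessarily
self-contragredient, we have `∑_{n ≤ x} Λ(n) |a_π(n)|² ∼ x`." Here (p. 484)
`a_π(p^k) = ∑_{1 ≤ j ≤ m} α_π(p, j)^k` with `α_π(p, j)` the local parameters of `π_p`, and the proof
(p. 492) is Ikehara's Tauberian theorem applied to `−L'/L(s, π × π̃)`, using RS1 (absolute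
convergence for `Re s > 1`, Jacquet–Shalika), RS3 (the only pole on `Re s ≥ 1` is the simple pole
at `s = 1`, Jacquet–Shalika / Mœglin–Waldspurger) and RS5 (non-vanishing on `Re s ≥ 1`, Shahidi)
listed on pp. 487–488. The self-contragredient hypothesis of the paper's Theorem 2.3 (the PNT with
the de la Vallée-Poussin error term) is NOT needed for Lemma 5.2, as printed. Earlier:
Liu–Wang–Ye 2005 (the special case `∑ Λ(n)|a_π(n)|²`, cited ibid. p. 485).

## Rendering and what is NOT claimed

* The printed sum runs over ALL prime powers `n = p^k ≤ x`, the ramified primes entering through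
  their local parameters. The tree's Satake families live off a finite set `S ⊇` (ramified places)
  (`IsSatakeFamilyOf P S α`, `AutomorphicLFunction`), so the fact is rendered for the PARTIAL sum
  over `v ∉ S`: `∑_{v ∉ S, q_v^k ≤ x, k ≥ 1} log q_v · |∑_{a ∈ α v} a^k|² ∼ x`. The two forms are
  equivalent: the printed Ikehara argument applies verbatim to `−(L^S)'/L^S(s, π × π̃)` (removing
  finitely many local factors, holomorphic and non-vanishing on `Re s ≥ 1`, keeps RS1/RS3/RS5 and
  the non-negativity of the Dirichlet coefficients `log q_v |∑_j α_j(v)^k|²`), and conversely the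
  finitely many omitted places contribute `o(x)` by the bounds towards Ramanujan
  (Luo–Rudnick–Sarnak; for `m = 2` Kim–Sarnak). This equivalence is bookkeeping, recorded here and
  not hidden: the Lean statement is the partial form.
* `k` ranges over `1 ≤ k ≤ Nat.log q_v ⌊x⌋₊`, i.e. exactly the prime powers `q_v^k ≤ ⌊x⌋`; the
  set `{v ∉ S | q_v ≤ x}` is finite (finitely many places of bounded norm), so `∑ᶠ` is an honest
  finite sum; `/ x` has its junk value only at `x = 0`, irrelevant along `atTop`.
* Base field `ℚ` only and the `L²` model only, as printed ("`GL_m` over `ℚ`"); `n ≥ 1` is the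
  hypothesis `0 < n` as in the neighbouring Jacquet–Shalika facts. Consumers holding a
  Borel–Jacquet datum `CuspidalAutomorphicRepData n ℚ hcpt` pass to this model through
  `CuspidalAutomorphicRepData.exists_isAssociatedL2_hasSatakeParamAt_eventually` /
  `hasSatakeParamAt_iff_L2_eventually` (`LanglandsTunnellBridgeTwoFacts`).
* NOT here: the off-diagonal theorem (Thm. 2.3, Selberg orthogonality `∑ Λ(n) a_π(n) ā_{π'}(n) =
  o(x)` for `π' ≇ π ⊗ |det|^{iτ}`, which needs one of `π, π'` self-contragredient in print), the
  error term `O(x exp(−c√log x))` of Lemma 5.1 (self-contragredient `π`), and the Mertens form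
  Cor. 2.4. Grounds the route item
  `Summit.Langlands.Langlands.Theses.GaloisWeightedBE.RankinSelbergPrimeMeanSquare` (`n = 2`; the
  item keeps only `k = 1`, the prime powers `k ≥ 2` being `o(x)` by Kim–Sarnak — prover's glue).
-/

noncomputable section

open scoped MatrixGroups Topology
open NumberField IsDedekindDomain MeasureTheory Filter

namespace Literature.NumberTheory.Automorphic

open AdelicGroupData

section Facts

variable {n : ℕ} {μ : Measure (gl n ℚ).automorphicQuotient} [(gl n ℚ).IsAutomorphicMeasure μ]

/-- **Liu–Ye 2007, Lemma 5.2 (prime number theorem for `L(s, π × π̃)`, no self-contragredience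
assumed), partial-sum form.** For a unitary cuspidal automorphic representation `π` of
`GL_n(𝔸_ℚ)` (`n ≥ 1`) with Satake family `α` off a finite set `S` of finite places:
`(1/x) ∑_{v ∉ S, q_v ≤ x} ∑_{k ≥ 1, q_v^k ≤ x} log q_v · |∑_{a ∈ α v} a^k|² → 1` as `x → ∞` —
printed as `∑_{n ≤ x} Λ(n)|a_π(n)|² ∼ x`, `a_π(p^k) = ∑_j α_π(p, j)^k` (Pure Appl. Math. Q. 3
(2007), Lemma 5.2, p. 492; proof: Ikehara's Tauberian theorem for `−L'/L(s, π × π̃)` from the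
Jacquet–Shalika pole and Shahidi's non-vanishing on `Re s = 1`). See the module docstring for
the (bookkeeping) passage between the full and the partial sum. Named fact (D-0014), statement
only. [cite: LiuYe2007, Lemma 5.2 (p. 492)] -/
def LiuYe2007_pnt_rankinSelberg_diag : Prop :=
  ∀ (_hn : 0 < n) (P : CuspidalAutomorphicRepGL n ℚ μ) {S : Set (HeightOneSpectrum (𝓞 ℚ))}
    (_hS : S.Finite) {α : SatakeFamily ℚ} (_hα : IsSatakeFamilyOf P S α),
    Tendsto (fun x : ℝ =>
        (∑ᶠ v ∈ {v : HeightOneSpectrum (𝓞 ℚ) | v ∉ S ∧ (v.residueCard : ℝ) ≤ x},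
          ∑ k ∈ Finset.Icc 1 (Nat.log v.residueCard ⌊x⌋₊),
            Real.log (v.residueCard : ℝ) * ‖((α v).map (· ^ k)).sum‖ ^ 2) / x)
      atTop (𝓝 1)

end Facts

end Literature.NumberTheory.Automorphic

end
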